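import Summits.Ventures.PercRepro.ProfilePointedCircuitClassesStarSharpZ
import Summits.Ventures.PercRepro.ProfilePointedCircuitClassesStarSharpW

/-! # The parallel-twin-of-`e` regime (D1) of `StarNineSharp`: the dictionary (p5 g53, §80 ADD 9(b)–(c))

`parallel_twin_e_core_iff` (StarSharpW) reduces the inequality of `StarNineSharp` at `(e, f)`, when `e` has a
parallel twin `x ∉ {f, b′}`, to the factor-two count `#{W ∈ BI₄(N) : e ∈ W ∌ f, b′ ∉ W} ≤ 2·#{W : e, f ∈ W, b′ ∉ W}`.
Here that count is derived from the six-point lemma `sixpoint_lemma` (StarSharpZ) applied to the four points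
`Q = E₇ − e − x − f`, the set `B = {e, b′}` (so that `rk_{M″}(S) = rk N (S ∪ B) − 2` on `M″ = (N ／ {e, b′}) ∖ x`) and
the marks `f`, `b`: the sets `W ∋ e` avoiding `b′` are of Type I (`b ∈ W`, `W = {e, b} ∪ π`) or Type II (`b ∉ W`,
`W = {e} ∪ τ`); Type II sets of the left family inject into the OFF Type I sets of the right family, OFF Type I sets
of the left family inject into the Type II sets of the right family, and the ON Type I sets are counted by the
six-point lemma. -/

open scoped Matroid

namespace PercRepro.Cogirth

open Finset ThmH Skew Shadow Profile

variable {α : Type} [DecidableEq α] {N : Matroid α} [N.Finite]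

section StarSharpD1

/-- `S ∪ {e, b′} = insert b′ (insert e S)`. -/
theorem union_pair_eq_insert_insert (S : Finset α) (e b' : α) : S ∪ {e, b'} = insert b' (insert e S) := by
  ext z; simp only [mem_union, mem_insert, mem_singleton]; tauto

/-- Modulo `B = {e, b′}` the rank of a subset `S` of `E₇` is `ρ(S + e) + 1`: `b′` adds one to every subset of `E₇`. -/
theorem rk_union_eb'_eq {b b' e : α} (h : SeriesPair N b b') (he : e ∈ ((gr N).erase b).erase b') {S : Finset α}
    (hS : S ⊆ ((gr N).erase b).erase b') : rk N (S ∪ {e, b'}) = rk N (insert e S) + 1 := by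
  rw [union_pair_eq_insert_insert]
  exact rk_insert_right_eq_add_one_of_seriesPair h (insert_subset he hS)

/-- `ρ({e, b′}) = 2` when `e ∈ E₇` is not a loop. -/
theorem rk_pair_eb'_eq_two {b b' e : α} (h : SeriesPair N b b') (he : e ∈ ((gr N).erase b).erase b')
    (he1 : rk N {e} = 1) : rk N ({e, b'} : Finset α) = 2 := by
  have : ({e, b'} : Finset α) = insert b' {e} := by
    ext z; simp only [mem_insert, mem_singleton]; tauto
  rw [this, rk_insert_right_eq_add_one_of_seriesPair h (singleton_subset_iff.2 he), he1]

/-- Membership in `Q = E₇ − e − x − f` unpacked. -/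
theorem mem_Q_unpack {b b' e x f u : α} (hu : u ∈ (((((gr N).erase b).erase b').erase e).erase x).erase f) :
    u ≠ f ∧ u ≠ x ∧ u ≠ e ∧ u ∈ ((gr N).erase b).erase b' :=
  ⟨(mem_erase.1 hu).1, (mem_erase.1 (mem_erase.1 hu).2).1, (mem_erase.1 (mem_erase.1 (mem_erase.1 hu).2).2).1,
    (mem_erase.1 (mem_erase.1 (mem_erase.1 hu).2).2).2⟩

/-- The complement of `{e, u, v}` in `E₇`, for `u, v ∈ Q = E₇ − e − x − f`: `E₇ ∖ {e, u, v} = {x, f} ∪ (Q − u − v)`. -/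
theorem E7_sdiff_triple_eq {b b' e x f u v : α} (hx : x ∈ ((gr N).erase b).erase b') (hf : f ∈ ((gr N).erase b).erase b')
    (hxe : x ≠ e) (hfe : f ≠ e) (hfx : f ≠ x)
    (hu : u ∈ (((((gr N).erase b).erase b').erase e).erase x).erase f)
    (hv : v ∈ (((((gr N).erase b).erase b').erase e).erase x).erase f) :
    ((gr N).erase b).erase b' \ {e, u, v} =
      insert x (insert f ((((((((gr N).erase b).erase b').erase e).erase x).erase f).erase u).erase v)) := by
  obtain ⟨huf, hux, hue, huE⟩ := mem_Q_unpack hu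
  obtain ⟨hvf, hvx, hve, hvE⟩ := mem_Q_unpack hv
  set E7 := ((gr N).erase b).erase b' with hE7
  ext z
  simp only [mem_sdiff, mem_insert, mem_singleton, mem_erase, ne_eq, not_or]
  constructor
  · rintro ⟨hzE, hze, hzu, hzv⟩
    by_cases hzx : z = x
    · exact Or.inl hzx
    · by_cases hzf : z = f
      · exact Or.inr (Or.inl hzf)
      · exact Or.inr (Or.inr ⟨hzv, hzu, hzf, hzx, hze, hzE⟩)
  · rintro (rfl | rfl | ⟨hzv, hzu, _, _, hze, hzE⟩)
    · exact ⟨hx, hxe, fun h => hux h.symm, fun h => hvx h.symm⟩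
    · exact ⟨hf, hfe, fun h => huf h.symm, fun h => hvf h.symm⟩
    · exact ⟨hzE, hze, hzu, hzv⟩

/-- **Type I membership**: for `u ≠ v` in `Q`, `{e, b, u, v} ∈ BI₄(N)` iff `ρ{e, u, v} = 3` and
`ρ({e, f} ∪ (Q − u − v)) = 4` (the complement `{x, f} ∪ (Q − u − v)` has the rank of `{e, f} ∪ (Q − u − v)`). -/
theorem typeI_mem_iff {b b' e x f u v : α} (h : SeriesPair N b b') (hn : (gr N).card = 9)
    (he : e ∈ ((gr N).erase b).erase b') (hx : x ∈ ((gr N).erase b).erase b') (hf : f ∈ ((gr N).erase b).erase b')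
    (hxe : x ≠ e) (hfe : f ≠ e) (hfx : f ≠ x) (he1 : rk N {e} = 1) (hx1 : rk N {x} = 1) (hex : rk N {e, x} = 1)
    (hu : u ∈ (((((gr N).erase b).erase b').erase e).erase x).erase f)
    (hv : v ∈ (((((gr N).erase b).erase b').erase e).erase x).erase f) (huv : u ≠ v) :
    insert b {e, u, v} ∈ biIndepSets N 4 ↔ rk N {e, u, v} = 3 ∧
      rk N (insert e (insert f ((((((((gr N).erase b).erase b').erase e).erase x).erase f).erase u).erase v))) = 4 := by
  obtain ⟨huf, hux, hue, huE⟩ := mem_Q_unpack hu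
  obtain ⟨hvf, hvx, hve, hvE⟩ := mem_Q_unpack hv
  have hY : ({e, u, v} : Finset α) ⊆ ((gr N).erase b).erase b' :=
    insert_subset he (insert_subset huE (singleton_subset_iff.2 hvE))
  have hY3 : ({e, u, v} : Finset α).card = 3 := by
    rw [card_insert_of_notMem, card_insert_of_notMem (by simpa using huv), card_singleton]
    simp only [mem_insert, mem_singleton, not_or]
    exact ⟨fun h => hue h.symm, fun h => hve h.symm⟩
  rw [insert_b_mem_biIndepSets_iff h hn hY hY3, E7_sdiff_triple_eq hx hf hxe hfe hfx hu hv]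
  have hZ : insert f ((((((((gr N).erase b).erase b').erase e).erase x).erase f).erase u).erase v) ⊆ gr N := by
    intro z hz
    rcases mem_insert.1 hz with rfl | hz
    · exact mem_of_mem_erase (mem_of_mem_erase hf)
    · exact mem_of_mem_erase (mem_of_mem_erase (mem_Q_unpack (mem_of_mem_erase (mem_of_mem_erase hz))).2.2.2)
  have hxg : x ∈ gr N := mem_of_mem_erase (mem_of_mem_erase hx)
  have heg : e ∈ gr N := mem_of_mem_erase (mem_of_mem_erase he)
  rw [rk_insert_eq_of_parallel' hxg heg hx1 he1 (by rw [pair_comm]; exact hex) hZ]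

/-- The complement of `{e, f, u}` in `E₇`, for `u ∈ Q`: `E₇ ∖ {e, f, u} = {x} ∪ (Q − u)`. -/
theorem E7_sdiff_triple_f_eq {b b' e x f u : α} (hx : x ∈ ((gr N).erase b).erase b') (hxe : x ≠ e) (hfx : f ≠ x)
    (hu : u ∈ (((((gr N).erase b).erase b').erase e).erase x).erase f) :
    ((gr N).erase b).erase b' \ {e, f, u} = insert x (((((((gr N).erase b).erase b').erase e).erase x).erase f).erase u) := by
  obtain ⟨huf, hux, hue, huE⟩ := mem_Q_unpack hu
  set E7 := ((gr N).erase b).erase b' with hE7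
  ext z
  simp only [mem_sdiff, mem_insert, mem_singleton, mem_erase, ne_eq, not_or]
  constructor
  · rintro ⟨hzE, hze, hzf, hzu⟩
    by_cases hzx : z = x
    · exact Or.inl hzx
    · exact Or.inr ⟨hzu, hzf, hzx, hze, hzE⟩
  · rintro (rfl | ⟨hzu, hzf, _, hze, hzE⟩)
    · exact ⟨hx, hxe, fun h => hfx h.symm, fun h => hux h.symm⟩
    · exact ⟨hzE, hze, hzf, hzu⟩

/-- **Type I membership through `f`**: for `u ∈ Q`, `{e, b, f, u} ∈ BI₄(N)` iff `ρ{e, f, u} = 3` and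
`ρ({e} ∪ (Q − u)) = 4`. -/
theorem typeI_f_mem_iff {b b' e x f u : α} (h : SeriesPair N b b') (hn : (gr N).card = 9)
    (he : e ∈ ((gr N).erase b).erase b') (hx : x ∈ ((gr N).erase b).erase b') (hf : f ∈ ((gr N).erase b).erase b')
    (hxe : x ≠ e) (hfe : f ≠ e) (hfx : f ≠ x) (he1 : rk N {e} = 1) (hx1 : rk N {x} = 1) (hex : rk N {e, x} = 1)
    (hu : u ∈ (((((gr N).erase b).erase b').erase e).erase x).erase f) :
    insert b {e, f, u} ∈ biIndepSets N 4 ↔ rk N {e, f, u} = 3 ∧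
      rk N (insert e (((((((gr N).erase b).erase b').erase e).erase x).erase f).erase u)) = 4 := by
  obtain ⟨huf, hux, hue, huE⟩ := mem_Q_unpack hu
  have hY : ({e, f, u} : Finset α) ⊆ ((gr N).erase b).erase b' :=
    insert_subset he (insert_subset hf (singleton_subset_iff.2 huE))
  have hY3 : ({e, f, u} : Finset α).card = 3 := by
    rw [card_insert_of_notMem, card_insert_of_notMem (by simpa using huf.symm), card_singleton]
    simp only [mem_insert, mem_singleton, not_or]
    exact ⟨hfe.symm, fun h => hue h.symm⟩
  rw [insert_b_mem_biIndepSets_iff h hn hY hY3, E7_sdiff_triple_f_eq hx hxe hfx hu]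
  have hZ : (((((((gr N).erase b).erase b').erase e).erase x).erase f).erase u) ⊆ gr N := fun z hz =>
    mem_of_mem_erase (mem_of_mem_erase (mem_Q_unpack (mem_of_mem_erase hz)).2.2.2)
  have hxg : x ∈ gr N := mem_of_mem_erase (mem_of_mem_erase hx)
  have heg : e ∈ gr N := mem_of_mem_erase (mem_of_mem_erase he)
  rw [rk_insert_eq_of_parallel' hxg heg hx1 he1 (by rw [pair_comm]; exact hex) hZ]

/-- `insert b′ (insert b {e, u, v}) = {u, v, b} ∪ {e, b′}`. -/
theorem insert_b'_insert_b_eq (b b' e u v : α) :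
    insert b' (insert b ({e, u, v} : Finset α)) = {u, v, b} ∪ {e, b'} := by
  ext z; simp only [mem_union, mem_insert, mem_singleton]; tauto

/-- `insert b′ (insert b {e, f, u}) = {f, u, b} ∪ {e, b′}`. -/
theorem insert_b'_insert_b_f_eq (b b' e f u : α) :
    insert b' (insert b ({e, f, u} : Finset α)) = {f, u, b} ∪ {e, b'} := by
  ext z; simp only [mem_union, mem_insert, mem_singleton]; tauto

/-- **Structure of a Type I set**: `W ∈ BI₄(N)` with `e, b ∈ W` and `f, b′ ∉ W` (and `e ∥ x`) is `insert b {e, u, v}`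
for two distinct points `u, v ∈ Q`. -/
theorem typeI_structure {b b' e x f : α} (h : SeriesPair N b b')
    (he : e ∈ ((gr N).erase b).erase b') (hxe : x ≠ e) (hex : rk N {e, x} = 1)
    {W : Finset α} (hW : W ∈ biIndepSets N 4) (heW : e ∈ W) (hfW : f ∉ W) (hb'W : b' ∉ W) (hbW : b ∈ W) :
    ∃ u v, u ∈ (((((gr N).erase b).erase b').erase e).erase x).erase f ∧
      v ∈ (((((gr N).erase b).erase b').erase e).erase x).erase f ∧ u ≠ v ∧ W = insert b {e, u, v} := by
  have hxW : x ∉ W := fun hxW => not_and_of_parallel' hxe.symm hex hW ⟨heW, hxW⟩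
  obtain ⟨hWg, hWc, -, -⟩ := mem_biIndepSets.1 hW
  have hbb' : b ≠ b' := h.2.2.1
  have heb : e ≠ b := (mem_erase.1 (mem_erase.1 he).2).1
  set P := (W.erase b).erase e with hP
  have hPc : P.card = 2 := by
    rw [hP, card_erase_of_mem (mem_erase.2 ⟨heb, heW⟩), card_erase_of_mem hbW, hWc]
  obtain ⟨u, v, huv, hPuv⟩ := card_eq_two.1 hPc
  have hPQ : P ⊆ (((((gr N).erase b).erase b').erase e).erase x).erase f := by
    intro z hz
    obtain ⟨hze, hzb, hzW⟩ : z ≠ e ∧ z ≠ b ∧ z ∈ W := ⟨(mem_erase.1 hz).1, (mem_erase.1 (mem_erase.1 hz).2).1,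
      (mem_erase.1 (mem_erase.1 hz).2).2⟩
    refine mem_erase.2 ⟨fun h' => hfW (h' ▸ hzW), mem_erase.2 ⟨fun h' => hxW (h' ▸ hzW), mem_erase.2 ⟨hze,
      mem_erase.2 ⟨fun h' => hb'W (h' ▸ hzW), mem_erase.2 ⟨hzb, hWg hzW⟩⟩⟩⟩⟩
  refine ⟨u, v, hPQ (hPuv ▸ mem_insert_self u {v}), hPQ (hPuv ▸ mem_insert_of_mem (mem_singleton_self v)), huv, ?_⟩
  rw [← insert_erase hbW, ← insert_erase (mem_erase.2 ⟨heb, heW⟩ : e ∈ W.erase b), ← hP, hPuv]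

/-- **Structure of a Type II set**: `W ∈ BI₄(N)` with `e ∈ W` and `f, b, b′ ∉ W` (and `e ∥ x`) is `insert e τ` for a
three-element `τ ⊆ Q`, and `Q ∖ W` is a single point. -/
theorem typeII_structure {b b' e x f : α} (h : SeriesPair N b b') (hn : (gr N).card = 9)
    (he : e ∈ ((gr N).erase b).erase b') (hx : x ∈ ((gr N).erase b).erase b') (hf : f ∈ ((gr N).erase b).erase b')
    (hxe : x ≠ e) (hfe : f ≠ e) (hfx : f ≠ x) (hex : rk N {e, x} = 1)
    {W : Finset α} (hW : W ∈ biIndepSets N 4) (heW : e ∈ W) (hfW : f ∉ W) (hb'W : b' ∉ W) (hbW : b ∉ W) :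
    W.erase e ⊆ (((((gr N).erase b).erase b').erase e).erase x).erase f ∧ (W.erase e).card = 3 ∧
      ∃ u, u ∈ (((((gr N).erase b).erase b').erase e).erase x).erase f ∧
        (((((gr N).erase b).erase b').erase e).erase x).erase f \ W = {u} ∧
        (((((gr N).erase b).erase b').erase e).erase x).erase f = insert u (W.erase e) := by
  have hxW : x ∉ W := fun hxW => not_and_of_parallel' hxe.symm hex hW ⟨heW, hxW⟩
  obtain ⟨hWg, hWc, -, -⟩ := mem_biIndepSets.1 hW
  set Q := (((((gr N).erase b).erase b').erase e).erase x).erase f with hQdef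
  have hQsub : W.erase e ⊆ Q := by
    intro z hz
    obtain ⟨hze, hzW⟩ := mem_erase.1 hz
    refine mem_erase.2 ⟨fun h' => hfW (h' ▸ hzW), mem_erase.2 ⟨fun h' => hxW (h' ▸ hzW), mem_erase.2 ⟨hze,
      mem_erase.2 ⟨fun h' => hb'W (h' ▸ hzW), mem_erase.2 ⟨fun h' => hbW (h' ▸ hzW), hWg hzW⟩⟩⟩⟩⟩
  have hc3 : (W.erase e).card = 3 := by rw [card_erase_of_mem heW, hWc]
  have hQ4 : (Q).card = 4 := by
    rw [card_erase_of_mem (mem_erase.2 ⟨hfx, mem_erase.2 ⟨hfe, hf⟩⟩), card_erase_of_mem (mem_erase.2 ⟨hxe, hx⟩),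
      card_erase_of_mem he, card_erase_of_mem (mem_erase.2 ⟨h.2.2.1.symm, h.2.1⟩), card_erase_of_mem h.1, hn]
  have hsd : (Q \ W).card = 1 := by
    have e1 : Q \ W =
        Q \ W.erase e := by
      ext z
      simp only [mem_sdiff, mem_erase, not_and]
      constructor
      · rintro ⟨hz, hzW⟩
        exact ⟨hz, fun _ => hzW⟩
      · rintro ⟨hz, hzW⟩
        exact ⟨hz, fun h' => hzW (mem_erase.1 (mem_erase.1 (mem_erase.1 hz).2).2).1 h'⟩
    rw [e1, card_sdiff_of_subset hQsub, hc3, hQ4]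
  obtain ⟨u, hu⟩ := card_eq_one.1 hsd
  refine ⟨hQsub, hc3, u, ?_, hu, ?_⟩
  · exact (mem_sdiff.1 (hu ▸ mem_singleton_self u)).1
  · have huW : u ∉ W := (mem_sdiff.1 (hu ▸ mem_singleton_self u)).2
    ext z
    simp only [mem_insert, mem_erase]
    constructor
    · intro hz
      by_cases hzW : z ∈ W
      · exact Or.inr ⟨(mem_erase.1 (mem_erase.1 (mem_erase.1 hz).2).2).1, hzW⟩
      · left
        have : z ∈ ({u} : Finset α) := hu ▸ mem_sdiff.2 ⟨hz, hzW⟩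
        exact mem_singleton.1 this
    · rintro (rfl | ⟨hze, hzW⟩)
      · exact (mem_sdiff.1 (hu ▸ mem_singleton_self z)).1
      · exact hQsub (mem_erase.2 ⟨hze, hzW⟩)

/-- Membership in `Q`, packed. -/
theorem mem_Q_pack {b b' e x f u : α} (huf : u ≠ f) (hux : u ≠ x) (hue : u ≠ e) (huE : u ∈ ((gr N).erase b).erase b') :
    u ∈ (((((gr N).erase b).erase b').erase e).erase x).erase f :=
  mem_erase.2 ⟨huf, mem_erase.2 ⟨hux, mem_erase.2 ⟨hue, huE⟩⟩⟩

/-- For a Type II set `W = insert e τ` with `Q = insert u τ`: `E₇ ∖ W = {x, f, u}`. -/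
theorem E7_sdiff_typeII_eq {b b' e x f u : α} (hx : x ∈ ((gr N).erase b).erase b') (hf : f ∈ ((gr N).erase b).erase b')
    (hxe : x ≠ e) (hfe : f ≠ e) (hfx : f ≠ x) {W : Finset α} (heW : e ∈ W) (hxW : x ∉ W) (hfW : f ∉ W)
    (hu : u ∈ (((((gr N).erase b).erase b').erase e).erase x).erase f) (huW : u ∉ W)
    (hQ : (((((gr N).erase b).erase b').erase e).erase x).erase f = insert u (W.erase e)) :
    ((gr N).erase b).erase b' \ W = {x, f, u} := by
  obtain ⟨huf, hux, hue, huE⟩ := mem_Q_unpack hu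
  ext z
  simp only [mem_sdiff, mem_insert, mem_singleton]
  constructor
  · rintro ⟨hzE, hzW⟩
    by_cases hzx : z = x
    · exact Or.inl hzx
    · by_cases hzf : z = f
      · exact Or.inr (Or.inl hzf)
      · right; right
        have hzQ : z ∈ insert u (W.erase e) := hQ ▸ mem_Q_pack hzf hzx (fun h => hzW (h ▸ heW)) hzE
        rcases mem_insert.1 hzQ with h | h
        · exact h
        · exact absurd (mem_of_mem_erase h) hzW
  · rintro (rfl | rfl | rfl)
    · exact ⟨hx, hxW⟩
    · exact ⟨hf, hfW⟩
    · exact ⟨huE, huW⟩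

/-- `insert b (insert b′ {y, f, u}) = insert y (insert b (insert b′ {f, u}))`. -/
theorem insert_bb'_triple_eq (b b' y f u : α) :
    insert b (insert b' ({y, f, u} : Finset α)) = insert y (insert b (insert b' {f, u})) := by
  ext z; simp only [mem_insert, mem_singleton]; tauto

/-- `insert b (insert f (insert e {u})) = insert b {e, f, u}`. -/
theorem insert_bfe_singleton_eq (b f e u : α) :
    insert b (insert f (insert e ({u} : Finset α))) = insert b ({e, f, u} : Finset α) := by
  ext z; simp only [mem_insert, mem_singleton]; tauto

/-- `ρ(insert b (insert b′ S)) = 5` with `#S ≤ 3` forces `ρ(S) = 3`. -/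
theorem rk_eq_three_of_insert_insert_eq_five {b b' : α} {S : Finset α} (hb : b ∈ gr N) (hb' : b' ∈ gr N)
    (hS : S ⊆ gr N) (hS3 : S.card ≤ 3) (h5 : rk N (insert b (insert b' S)) = 5) : rk N S = 3 := by
  have h1 : rk N (insert b (insert b' S)) ≤ rk N (insert b' S) + 1 := rk_insert_le_add_one hb (insert_subset hb' hS)
  have h2 : rk N (insert b' S) ≤ rk N S + 1 := rk_insert_le_add_one hb' hS
  have h3 := rk_le_card' (M := N) S
  omega

/-- `#{e, f, u} ≤ 3`. -/
theorem card_triple_le_three (e f u : α) : ({e, f, u} : Finset α).card ≤ 3 := by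
  refine (card_insert_le _ _).trans ?_
  refine Nat.succ_le_succ ((card_insert_le _ _).trans ?_)
  rw [card_singleton]

/-- **Injection (A)**: a Type II set `W = insert e τ` of the left family goes to the OFF Type I set
`{e, b, f, u}`, `u = Q ∖ W`, of the right family. -/
theorem typeII_image_mem {b b' e x f : α} (h : SeriesPair N b b') (hn : (gr N).card = 9)
    (he : e ∈ ((gr N).erase b).erase b') (hx : x ∈ ((gr N).erase b).erase b') (hf : f ∈ ((gr N).erase b).erase b')
    (hxe : x ≠ e) (hfe : f ≠ e) (hfx : f ≠ x) (he1 : rk N {e} = 1) (hx1 : rk N {x} = 1) (hex : rk N {e, x} = 1)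
    {W : Finset α} (hW : W ∈ biIndepSets N 4) (heW : e ∈ W) (hfW : f ∉ W) (hb'W : b' ∉ W) (hbW : b ∉ W) :
    insert b (insert f (insert e ((((((gr N).erase b).erase b').erase e).erase x).erase f \ W))) ∈ biIndepSets N 4 ∧
      ¬ rk N (insert b' (insert b (insert f (insert e ((((((gr N).erase b).erase b').erase e).erase x).erase f \ W)))))
        ≤ 4 := by
  obtain ⟨hτQ, hτ3, u, hu, hQW, hQ⟩ := typeII_structure h hn he hx hf hxe hfe hfx hex hW heW hfW hb'W hbW
  have hxW : x ∉ W := fun hxW => not_and_of_parallel' hxe.symm hex hW ⟨heW, hxW⟩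
  have huW : u ∉ W := (mem_sdiff.1 (hQW ▸ mem_singleton_self u)).2
  obtain ⟨huf, hux, hue, huE⟩ := mem_Q_unpack hu
  rw [hQW, insert_bfe_singleton_eq]
  have hb'g : b' ∈ gr N := h.2.1
  have hbg : b ∈ gr N := h.1
  have hWE : W ⊆ ((gr N).erase b).erase b' := fun z hz =>
    mem_erase.2 ⟨fun h' => hb'W (h' ▸ hz), mem_erase.2 ⟨fun h' => hbW (h' ▸ hz), (mem_biIndepSets.1 hW).1 hz⟩⟩
  have hW4 : W.card = 4 := (mem_biIndepSets.1 hW).2.1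
  obtain ⟨hWr, hWc⟩ := (mem_biIndepSets_iff_of_subset_E7 h hn hWE hW4).1 hW
  rw [E7_sdiff_typeII_eq hx hf hxe hfe hfx heW hxW hfW hu huW hQ, insert_bb'_triple_eq] at hWc
  have hxg : x ∈ gr N := mem_of_mem_erase (mem_of_mem_erase hx)
  have heg : e ∈ gr N := mem_of_mem_erase (mem_of_mem_erase he)
  have hfg : f ∈ gr N := mem_of_mem_erase (mem_of_mem_erase hf)
  have hug : u ∈ gr N := mem_of_mem_erase (mem_of_mem_erase huE)
  have hswap : rk N (insert b (insert b' ({e, f, u} : Finset α))) = 5 := by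
    rw [insert_bb'_triple_eq, ← rk_insert_eq_of_parallel' hxg heg hx1 he1 (by rw [pair_comm]; exact hex)
      (insert_subset hbg (insert_subset hb'g (insert_subset hfg (singleton_subset_iff.2 hug))))]
    exact hWc
  have hefu : rk N ({e, f, u} : Finset α) = 3 :=
    rk_eq_three_of_insert_insert_eq_five hbg hb'g (insert_subset heg (insert_subset hfg (singleton_subset_iff.2 hug)))
      (card_triple_le_three e f u) hswap
  have hτ : (((((((gr N).erase b).erase b').erase e).erase x).erase f).erase u) = W.erase e := by
    rw [hQ, erase_insert]
    intro h'
    exact huW (mem_of_mem_erase h')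
  refine ⟨?_, ?_⟩
  · rw [typeI_f_mem_iff h hn he hx hf hxe hfe hfx he1 hx1 hex hu, hτ, insert_erase heW]
    exact ⟨hefu, hWr⟩
  · rw [insert_comm, hswap]
    omega

end StarSharpD1

end PercRepro.Cogirth
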